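import Summits.QuantumFields.YangMills.Theorems.BalabanUVNodesN15KingModelCovariantBlockMean
import Summits.QuantumFields.YangMills.Theorems.BalabanUVNodesN15KingModelLandauBlockPenalty
import Summits.QuantumFields.YangMills.Theorems.BalabanUVNodesN15KingModelLandauStability
import Summits.QuantumFields.YangMills.Theorems.BalabanUVNodesN15KingModelCurvaturePlaquette
import HarnessLib

/-!
# BalabanUVNodes ∕ N15 — THE KING-MODEL RUNG (PART Ϥ-d): KING's ∕ BAŁABAN's FULL FINE OPERATOR `A₀(U) = −cΔ_U + m² + a·Q(U)^*Q(U)` AT EVERY LINK FIELD — King's `η`-adjoint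
# `Q(U)^* = L^{d+1}Q(U)ᴴ`, the block term `P_U = Q(U)^*Q(U)` (an ORTHOGONAL PROJECTION at every unitary `U`), `A₀(U)` ([King1986] (2.13), [B9] (3.24)–(3.26)): Hermitian, THE FORM
# IDENTITY `Re⟨v,A₀(U)v⟩ = m²Σ‖v_x‖² + cΣ bondE + aL^{d+1}Σ_y‖(Q(U)v)(y)‖²`, GAUGE COVARIANCE (3.34) BY NAME `A₀(U^g) = D_gA₀(U)D_g^*`, gauge invariance of every coercivity constant
# (Track A, DAG node N15 = NE2; FAN-OUT v1.1 §N15 s3 «KING-MODEL RUNG … + what the curved case adds»; count-neutral)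

HONEST FRAMING.  Count-neutral (cell `pub-ymgap`, seat `pub-ymgap-dag-n15-e` g49; `--supports stmt-QuantumFields-27247 --as helper` = K3ᴬ, KEY MAP v3).  The object is King's fine
minimisation operator (2.13) p.653 ∕ (4.5) p.670 — `A₀ = η^d(−Δ^η + m²) + aQ^*Q` in the normalisation of PART Ͷ-k (`fineOpTw`: King's `η`-adjoint `Q^* = N^{d+1}Qᴴ`; tree
`King1986.Torus.fineOp = lapF + a·blockProj` at `U ≡ 1`) — with Bałaban's covariant block mean (3.19) of PART Ϥ-c in place of King's `Q`; = Bałaban's `Δ_a = Δ^η_U + Q^*aQ` of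
(3.24)–(3.26) p.394–395 for ONE averaging level without the `DRD^*` term of the vector model.  NOT Bałaban's multi-level operator; NOT (3.42); NOT a node discharge (N15 of record
untouched); nothing continuum ∕ ℝ⁴ ∕ OS ∕ Clay.

RESULTS.  §1 defs `kingQadjU` (`Q(U)^* := L^{d+1}·Q(U)ᴴ`), `blockProjU` (`P_U := Q(U)^*Q(U)`), `fullOpU a c m² U := (−cΔ_U+m²) + (aL^{d+1})·Q(U)ᴴQ(U)` (PART Ͱ-a `covLapF` + PART Ϡ-i's penalty
shape), `fullOpU_eq` (`= covLapF + a·P_U`), `blockProjU_eq_kingQadjU_mul`; §2 ★ `isHermitian_blockProjU`, ★ `isHermitian_fullOpU`, ★★ **`blockProjU_mul_self`** (`P_U² = P_U` at every unitary `U`: Ϥ-c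
`Q(U)Q(U)^ᴴ = L^{−(d+1)}`), ★ `blockProjU_const_one_apply` (`U ≡ 1`: King's `Q^*Q ⊗ 1`, `= King1986.Torus.blockProj ⊗ 1` via `blockProjU_const_one_apply_eq_blockProj`); §3 `re_star_dotProduct_conjTranspose_mul_mulVec_eq`
(`Re⟨v,QᴴQv⟩ = Σ_y‖(Qv)_y‖²`), ★★★ **`re_quadForm_fullOpU`** (THE FORM IDENTITY), `re_quadForm_fullOpU_ge_covLapF` (the block term is `≥ 0`: Ϡ-i `coercive_add_penalty`); §4 ★★ `blockProjU_kingGaugeAct`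
(`P_{U^g} = D_gP_UD_g^*`), ★★★ **`fullOpU_kingGaugeAct`** ([B9] (3.34) «Δ_a(U^u) = R(u)Δ_a(U)R(u^{−1})» BY NAME in the model), ★★ **`coercive_fullOpU_kingGaugeAct`** (a form floor `κΣ‖v_x‖² ≤ Re⟨v,A₀(U)v⟩`
passes to every gauge transform of `U`).
PRIOR TREE ART (by name): Ϥ-c (`covQ`, `covQ_const_one_apply`, `covQ_mul_conjTranspose`, `covQ_kingGaugeAct`, `cornerGauge`), Ͱ-a (`covLapF`, `isHermitian_covLapF`, `kingGaugeMat`, `kingGaugeAct`,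
`covLapF_kingGaugeAct`, `kingGaugeMat_conjTranspose_mul_self`, `kingGaugeMat_mem_unitaryGroup`), Ͱ-b∕f (`fib`, `sum_norm_fib_sq`), Ϳ-b (`bondE`, `re_quadForm_covLapF_eq_bondE`), Ϡ-i (`isHermitian_add_penalty`,
`coercive_add_penalty`), Ϡ-e (`star_dotProduct_conj_mulVec`, `sum_norm_fib_sq_unitary`), `King1986.Torus` (`blockProj`, `blockOf`).  Dedup (rg at filing): basename 0 files; needles
`kingQadjU|blockProjU|fullOpU` 0 files in `Summits/QuantumFields/YangMills` + `Literature/MathematicalPhysics`.  presearch: n/a.  Locators: [King1986] (2.13) p.653, (4.1)–(4.5) p.670;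
[Balaban1985BackgroundPropagators] (3.19) p.393, (3.24) p.394, (3.26) p.395, (3.34) p.396; [Balaban1984PropagatorsI] (1.74) p.30.  0 `sorry`.
-/

noncomputable section
open scoped BigOperators ComplexConjugate
open Finset Matrix WithLp

namespace Summit.QuantumFields.YangMills.BalabanUVNodes.N15KingModelRung.CovariantBlock

open Literature.MathematicalPhysics.QuantumFieldTheory.Balaban1983to89.B5Prop11Plancherel (Tor fine unitVec)
open Literature.MathematicalPhysics.QuantumFieldTheory.King1986.Torus (site blockEquiv blockEquiv_apply blockOf blockOf_site blockProj)
open Summit.QuantumFields.YangMills.BalabanUVNodes.N15KingModelRung.Covariant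
  (covLapF isHermitian_covLapF kingGaugeMat kingGaugeAct covLapF_kingGaugeAct kingGaugeMat_conjTranspose_mul_self kingGaugeMat_mem_unitaryGroup fib fib_apply sum_norm_fib_sq)
open Summit.QuantumFields.YangMills.BalabanUVNodes.N15KingModelRung.Curvature (bondE re_quadForm_covLapF_eq_bondE)
open Summit.QuantumFields.YangMills.BalabanUVNodes.N15KingModelRung.Landau (isHermitian_add_penalty coercive_add_penalty star_dotProduct_conj_mulVec sum_norm_fib_sq_unitary)

variable {d : ℕ} {L : ℕ} [NeZero L] (T : BlockTree d L) (M : Fin (d + 1) → ℕ) [hM : ∀ μ, NeZero (M μ)]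
variable {𝕜 : Type*} [RCLike 𝕜] {n : Type*} [Fintype n] [DecidableEq n]

/-! ## §1 The objects -/

/-- KING's `η`-ADJOINT of the covariant block mean: `Q(U)^* := L^{d+1}·Q(U)ᴴ` (adjoint for the `η^{d+1}`-weighted fine inner product, `η = L⁻¹`; PART Ͷ-k `kingQadjTw` at a toron).
[cite: King1986, (2.11) p.653, (2.13) p.653; Balaban1984PropagatorsI, (1.74) p.30] -/
def kingQadjU (U : Tor (fine L M) × Fin (d + 1) → Matrix n n 𝕜) : Matrix (Tor (fine L M) × n) (Tor M × n) 𝕜 := ((L : 𝕜) ^ (d + 1)) • (covQ T M U)ᴴ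

/-- THE BLOCK TERM `P_U := Q(U)^*Q(U) = L^{d+1}·Q(U)ᴴQ(U)` (King's `Q^*Q` of (2.13)∕(4.5) with Bałaban's covariant mean; an orthogonal projection at unitary `U`, §2).
[cite: King1986, (2.13) p.653, (4.5) p.670; Balaban1985BackgroundPropagators, (3.24) p.394] -/
def blockProjU (U : Tor (fine L M) × Fin (d + 1) → Matrix n n 𝕜) : Matrix (Tor (fine L M) × n) (Tor (fine L M) × n) 𝕜 := ((L : 𝕜) ^ (d + 1)) • ((covQ T M U)ᴴ * covQ T M U)

/-- KING's ∕ BAŁABAN's FULL FINE OPERATOR `A₀(U) = (−cΔ_U + m²) + a·Q(U)^*Q(U)`, typed in PART Ϡ-i's penalty shape `covLapF + (aL^{d+1})·Q(U)ᴴQ(U)`.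
[cite: King1986, (2.13) p.653, (4.4)–(4.5) p.670; Balaban1985BackgroundPropagators, (3.24) p.394, (3.26) p.395] -/
def fullOpU (a c m2 : ℝ) (U : Tor (fine L M) × Fin (d + 1) → Matrix n n 𝕜) : Matrix (Tor (fine L M) × n) (Tor (fine L M) × n) 𝕜 :=
  covLapF (fine L M) c m2 U + ((a * (L : ℝ) ^ (d + 1) : ℝ) : 𝕜) • ((covQ T M U)ᴴ * covQ T M U)

/-- `P_U = Q(U)^*·Q(U)`. [cite: King1986, (2.13) p.653] -/
theorem blockProjU_eq_kingQadjU_mul (U : Tor (fine L M) × Fin (d + 1) → Matrix n n 𝕜) : blockProjU T M U = kingQadjU T M U * covQ T M U := by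
  rw [blockProjU, kingQadjU, Matrix.smul_mul]

/-- `A₀(U) = (−cΔ_U + m²) + a·P_U`. [cite: King1986, (2.13) p.653; Balaban1985BackgroundPropagators, (3.26) p.395] -/
theorem fullOpU_eq (a c m2 : ℝ) (U : Tor (fine L M) × Fin (d + 1) → Matrix n n 𝕜) : fullOpU T M a c m2 U = covLapF (fine L M) c m2 U + (a : 𝕜) • blockProjU T M U := by
  rw [fullOpU, blockProjU, smul_smul]
  congr 2
  push_cast; ring

/-! ## §2 Hermitian; the block term is a projection; `U ≡ 1` -/

/-- ★ `P_U` is Hermitian. [folklore] -/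
theorem isHermitian_blockProjU (U : Tor (fine L M) × Fin (d + 1) → Matrix n n 𝕜) : (blockProjU T M U).IsHermitian := by
  have hQ : ((covQ T M U)ᴴ * covQ T M U).IsHermitian := Matrix.isHermitian_conjTranspose_mul_self _
  unfold Matrix.IsHermitian at hQ ⊢
  rw [blockProjU, conjTranspose_smul, hQ, RCLike.star_def, map_pow, map_natCast]

/-- ★ `A₀(U)` is Hermitian (every link field). [cite: Balaban1985BackgroundPropagators, (3.26) p.395] -/
theorem isHermitian_fullOpU (a c m2 : ℝ) (U : Tor (fine L M) × Fin (d + 1) → Matrix n n 𝕜) : (fullOpU T M a c m2 U).IsHermitian :=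
  isHermitian_add_penalty (fine L M) (isHermitian_covLapF (fine L M) c m2 U) _ _

/-- ★★ **THE BLOCK TERM IS AN ORTHOGONAL PROJECTION AT EVERY UNITARY `U`**: `P_U² = P_U` (with `P_U^ᴴ = P_U`), since `Q(U)Q(U)ᴴ = L^{−(d+1)}` (Ϥ-c) — its range is the space of covariantly
block-constant fields `x ↦ U(Γ_{y,x})^*ξ_y`. [cite: King1986, (4.1)–(4.3) p.670; Balaban1985BackgroundPropagators, (3.19) p.393] -/
theorem blockProjU_mul_self {U : Tor (fine L M) × Fin (d + 1) → Matrix n n 𝕜} (hU : ∀ bd, U bd ∈ Matrix.unitaryGroup n 𝕜) :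
    blockProjU T M U * blockProjU T M U = blockProjU T M U := by
  have hL : ((L : 𝕜) ^ (d + 1)) ≠ 0 := pow_ne_zero _ (by exact_mod_cast NeZero.ne L)
  rw [blockProjU, Matrix.smul_mul, Matrix.mul_smul, smul_smul, Matrix.mul_assoc, ← Matrix.mul_assoc (covQ T M U), covQ_mul_conjTranspose T M hU, Matrix.smul_mul, Matrix.one_mul,
    Matrix.mul_smul, smul_smul]
  congr 1
  field_simp

/-- ★ AT `U ≡ 1`: `P_1((x,i),(x′,k)) = [x, x′ in the same block]·L^{−(d+1)}·δ_{ik}` — King's block-mean projector `Q^*Q` ⊗ 1. [cite: King1986, (4.36) p.674, (4.1) p.670] -/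
theorem blockProjU_const_one_apply (x x' : Tor (fine L M)) (i k : n) :
    blockProjU T M (fun _ => (1 : Matrix n n 𝕜)) (x, i) (x', k) = if blockOf L M x = blockOf L M x' ∧ i = k then ((L : 𝕜) ^ (d + 1))⁻¹ else 0 := by
  have hL : ((L : 𝕜) ^ (d + 1)) ≠ 0 := pow_ne_zero _ (by exact_mod_cast NeZero.ne L)
  rw [blockProjU, Matrix.smul_apply, Matrix.mul_apply, Fintype.sum_prod_type, smul_eq_mul]
  simp only [Matrix.conjTranspose_apply, covQ_const_one_apply]
  rw [Finset.sum_eq_single (blockOf L M x)]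
  · rw [Finset.sum_eq_single i]
    · simp only [true_and, if_true, RCLike.star_def, map_inv₀, map_pow, map_natCast]
      by_cases h : blockOf L M x = blockOf L M x' ∧ i = k
      · rw [if_pos ⟨h.1.symm, h.2⟩, if_pos h]; field_simp
      · rw [if_neg (fun h' => h ⟨h'.1.symm, h'.2⟩), if_neg h, mul_zero, mul_zero]
    · intro l _ hl; rw [if_neg (fun h => hl h.2), star_zero, zero_mul]
    · intro h; exact absurd (Finset.mem_univ i) h
  · intro y _ hy
    refine Finset.sum_eq_zero fun l _ => ?_
    rw [if_neg (fun h => hy h.1.symm), star_zero, zero_mul]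
  · intro h; exact absurd (Finset.mem_univ _) h

/-- The same, as King's real block-mean projector tensored with the identity on the fibre: `P_1((x,i),(x′,k)) = blockProj(x,x′)·δ_{ik}` (tree `King1986.Torus.blockProj`).
[cite: King1986, (4.36) p.674] -/
theorem blockProjU_const_one_apply_eq_blockProj (x x' : Tor (fine L M)) (i k : n) :
    blockProjU T M (fun _ => (1 : Matrix n n 𝕜)) (x, i) (x', k) = ((blockProj L M x x' : ℝ) : 𝕜) * (1 : Matrix n n 𝕜) i k := by
  rw [blockProjU_const_one_apply, blockProj, Matrix.one_apply]
  by_cases h1 : blockOf L M x = blockOf L M x'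
  · by_cases h2 : i = k
    · rw [if_pos ⟨h1, h2⟩, if_pos h1, if_pos h2, mul_one]; push_cast; rfl
    · rw [if_neg (fun h => h2 h.2), if_neg h2, mul_zero]
  · rw [if_neg (fun h => h1 h.1), if_neg h1]; push_cast; rw [zero_mul]

/-! ## §3 The form identity -/

omit [DecidableEq n] in
/-- `Re⟨v, QᴴQv⟩ = Σ_y‖(Qv)_y‖²` for any matrix `Q` into `T₁ × n`. [folklore] -/
theorem re_star_dotProduct_conjTranspose_mul_mulVec_eq (Q : Matrix (Tor M × n) (Tor (fine L M) × n) 𝕜) (v : Tor (fine L M) × n → 𝕜) :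
    RCLike.re (star v ⬝ᵥ ((Qᴴ * Q) *ᵥ v)) = ∑ y, ‖fib M (Q *ᵥ v) y‖ ^ 2 := by
  rw [← mulVec_mulVec, dotProduct_mulVec, ← star_mulVec, sum_norm_fib_sq, EuclideanSpace.norm_sq_eq]
  have h : star (Q *ᵥ v) ⬝ᵥ (Q *ᵥ v) = ∑ p, star ((Q *ᵥ v) p) * (Q *ᵥ v) p := rfl
  rw [h, map_sum]
  refine Finset.sum_congr rfl fun p _ => ?_
  rw [RCLike.star_def, RCLike.conj_mul, ← RCLike.ofReal_pow, RCLike.ofReal_re, PiLp.toLp_apply]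

/-- ★★★ **THE FORM IDENTITY**: for a unitary link field,
`Re⟨v, A₀(U)v⟩ = m²Σ_x‖v_x‖² + cΣ_xΣ_μ‖v_x − U(x,μ)v_{x+e_μ}‖² + a·L^{d+1}·Σ_y‖(Q(U)v)(y)‖²` — mass, covariant Dirichlet form (Ϳ-b `bondE`), and the block term (King: `a` times the squared
`η`-weighted norm of the block means). [cite: King1986, (2.13) p.653, (4.5) p.670; Balaban1985BackgroundPropagators, (3.23)–(3.24) p.394] -/
theorem re_quadForm_fullOpU (a c m2 : ℝ) {U : Tor (fine L M) × Fin (d + 1) → Matrix n n 𝕜} (hU : ∀ bd, U bd ∈ Matrix.unitaryGroup n 𝕜) (v : Tor (fine L M) × n → 𝕜) :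
    RCLike.re (star v ⬝ᵥ (fullOpU T M a c m2 U *ᵥ v))
      = m2 * ∑ x, ‖fib (fine L M) v x‖ ^ 2 + c * ∑ x, ∑ μ, bondE (fine L M) U v x μ + a * (L : ℝ) ^ (d + 1) * ∑ y, ‖fib M (covQ T M U *ᵥ v) y‖ ^ 2 := by
  rw [fullOpU, add_mulVec, dotProduct_add, map_add, Matrix.smul_mulVec, dotProduct_smul, smul_eq_mul, RCLike.re_ofReal_mul, re_quadForm_covLapF_eq_bondE (fine L M) c m2 hU v,
    re_star_dotProduct_conjTranspose_mul_mulVec_eq]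

/-- The block term only helps: a form floor of `−cΔ_U + m²` is a form floor of `A₀(U)` (`a ≥ 0`; PART Ϡ-i `coercive_add_penalty`). [cite: Balaban1985BackgroundPropagators, (3.24) p.394] -/
theorem re_quadForm_fullOpU_ge_covLapF {a : ℝ} (ha : 0 ≤ a) (c m2 : ℝ) (U : Tor (fine L M) × Fin (d + 1) → Matrix n n 𝕜) {κ : ℝ}
    (hcoer : ∀ v : Tor (fine L M) × n → 𝕜, κ * ∑ x, ‖fib (fine L M) v x‖ ^ 2 ≤ RCLike.re (star v ⬝ᵥ (covLapF (fine L M) c m2 U *ᵥ v))) (v : Tor (fine L M) × n → 𝕜) :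
    κ * ∑ x, ‖fib (fine L M) v x‖ ^ 2 ≤ RCLike.re (star v ⬝ᵥ (fullOpU T M a c m2 U *ᵥ v)) :=
  coercive_add_penalty (fine L M) hcoer (by positivity) _ v

/-! ## §4 Gauge covariance ([B9] (3.34)) -/

/-- ★★ `P_{U^g} = D_g·P_U·D_g^*` (from Ϥ-c (3.32): `Q(U^g) = D_cQ(U)D_g^*` and `D_c^*D_c = 1`). [cite: Balaban1985BackgroundPropagators, (3.32) p.395, (3.34) p.396] -/
theorem blockProjU_kingGaugeAct {g : Tor (fine L M) → Matrix n n 𝕜} (hg : ∀ x, g x ∈ Matrix.unitaryGroup n 𝕜) (U : Tor (fine L M) × Fin (d + 1) → Matrix n n 𝕜) :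
    blockProjU T M (kingGaugeAct (fine L M) g U) = kingGaugeMat (fine L M) g * blockProjU T M U * (kingGaugeMat (fine L M) g)ᴴ := by
  have hc : (kingGaugeMat M (cornerGauge T M g))ᴴ * kingGaugeMat M (cornerGauge T M g) = 1 :=
    kingGaugeMat_conjTranspose_mul_self M (cornerGauge_mem_unitaryGroup T M hg)
  rw [blockProjU, blockProjU, covQ_kingGaugeAct T M hg U, Matrix.conjTranspose_mul, Matrix.conjTranspose_mul, conjTranspose_conjTranspose, Matrix.mul_smul, Matrix.smul_mul]
  congr 1
  calc kingGaugeMat (fine L M) g * ((covQ T M U)ᴴ * (kingGaugeMat M (cornerGauge T M g))ᴴ) * (kingGaugeMat M (cornerGauge T M g) * covQ T M U * (kingGaugeMat (fine L M) g)ᴴ)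
      = kingGaugeMat (fine L M) g * (covQ T M U)ᴴ * ((kingGaugeMat M (cornerGauge T M g))ᴴ * kingGaugeMat M (cornerGauge T M g)) * covQ T M U * (kingGaugeMat (fine L M) g)ᴴ := by
        simp only [Matrix.mul_assoc]
    _ = kingGaugeMat (fine L M) g * ((covQ T M U)ᴴ * covQ T M U) * (kingGaugeMat (fine L M) g)ᴴ := by rw [hc, Matrix.mul_one]; simp only [Matrix.mul_assoc]

/-- ★★★ **GAUGE COVARIANCE OF THE FULL OPERATOR** ([B9] (3.34) «Δ_a(U^u) = R(u)Δ_a(U)R(u^{−1}), G(U^u) = R(u)G(U)R(u^{−1})» in the model): `A₀(U^g) = D_g·A₀(U)·D_g^*` for every unitary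
gauge `g`. [cite: Balaban1985BackgroundPropagators, (3.34) p.396, (3.31)–(3.32) p.395] -/
theorem fullOpU_kingGaugeAct (a c m2 : ℝ) {g : Tor (fine L M) → Matrix n n 𝕜} (hg : ∀ x, g x ∈ Matrix.unitaryGroup n 𝕜) (U : Tor (fine L M) × Fin (d + 1) → Matrix n n 𝕜) :
    fullOpU T M a c m2 (kingGaugeAct (fine L M) g U) = kingGaugeMat (fine L M) g * fullOpU T M a c m2 U * (kingGaugeMat (fine L M) g)ᴴ := by
  rw [fullOpU_eq, fullOpU_eq, covLapF_kingGaugeAct (fine L M) c m2 hg U, blockProjU_kingGaugeAct T M hg U, Matrix.mul_add, Matrix.add_mul, Matrix.mul_smul, Matrix.smul_mul]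

/-- ★★ **COERCIVITY CONSTANTS OF `A₀(U)` ARE GAUGE INVARIANT**: a floor `κ·Σ‖v_x‖² ≤ Re⟨v,A₀(U)v⟩` (all `v`) holds with the same `κ` for `A₀(U^g)`.
[cite: Balaban1985BackgroundPropagators, (3.34) p.396, p.398 l.19] -/
theorem coercive_fullOpU_kingGaugeAct (a c m2 : ℝ) {U : Tor (fine L M) × Fin (d + 1) → Matrix n n 𝕜} {g : Tor (fine L M) → Matrix n n 𝕜} (hg : ∀ x, g x ∈ Matrix.unitaryGroup n 𝕜) {κ : ℝ}
    (hcoer : ∀ v : Tor (fine L M) × n → 𝕜, κ * ∑ x, ‖fib (fine L M) v x‖ ^ 2 ≤ RCLike.re (star v ⬝ᵥ (fullOpU T M a c m2 U *ᵥ v))) (v : Tor (fine L M) × n → 𝕜) :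
    κ * ∑ x, ‖fib (fine L M) v x‖ ^ 2 ≤ RCLike.re (star v ⬝ᵥ (fullOpU T M a c m2 (kingGaugeAct (fine L M) g U) *ᵥ v)) := by
  rw [fullOpU_kingGaugeAct T M a c m2 hg U, star_dotProduct_conj_mulVec]
  have hD : (kingGaugeMat (fine L M) g)ᴴ ∈ Matrix.unitaryGroup (Tor (fine L M) × n) 𝕜 := by
    simpa only [star_eq_conjTranspose] using Unitary.star_mem (kingGaugeMat_mem_unitaryGroup (fine L M) hg)
  rw [← sum_norm_fib_sq_unitary (fine L M) hD v]
  exact hcoer _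

end Summit.QuantumFields.YangMills.BalabanUVNodes.N15KingModelRung.CovariantBlock

end
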